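import Summits.ResolutionOfSingularities.ResolutionOfSingularities.Theorems.MarkedTransferCampaignW12SandwichTSharp
import Literature.AlgebraicGeometry.Hironaka2017.DiffProduct
import Mathlib.Algebra.MvPolynomial.PDeriv
import Mathlib.RingTheory.MvPolynomial.Ideal
import Mathlib.Algebra.CharP.Two
import Mathlib.Algebra.CharP.Frobenius
import Mathlib.Tactic
import HarnessLib

/-!
# [OURS · L1 W1.2 · kill test K1.2] The box criterion for the Frobenius-sandwich negative modules,
# and the first R05 witness

LADDER-RESOLUTION rung L (rescue), cell `res-hironaka`, slot **W1.2** (plan/RESCUE-SEED.md §1 L-G1), kill test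
**K1.2** «does `T♯ ∌ 1` for the R05/R08 witnesses under the sandwich operators? (Lean, decide over 𝔽₂)»,
seat res-L1-k12; preregistration = HOME/STATUS.md line «KILL-TEST K1.2 REGISTERED» 2026-08-26T19:41:04Z;
report = HOME/L/res-L1-k12/KILL-TEST-K1.2.md. OBJECT UNDER TEST = the typed OURS decl
`Campaign.sandwichPNega p e P m a` of `MarkedTransferCampaignW12SandwichTSharp.lean` (res-L1-type-o2, p461383):
Def 5.1 (36) with the differential operators taken RELATIVE TO THE SUBRING `ρ^e(O)` (EGA-relative reading),
`P j = ℘(E,j)` the positive pieces, level `e` with `p^e = q = m` the exponent of (37).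

HONEST FRAMING. Nothing here is a statement of H. Hironaka's manuscript *Resolution of singularities in
positive characteristics* (2017-03-23, [Hironaka2017], lit key `paper:url-3343fd9e678b`); nothing here asserts or
denies any printed statement; nothing here is progress on resolution of singularities in characteristic `p`.
The objects are OURS ([OURS · L1 W1.2]); every theorem below is an elementary ring-level fact ([folklore]) about
them. `℘(E,·)` itself is NOT constructed in Lean anywhere in the tree: exactly as in the prior record's adopted
witness modules (`NegaWitness`, `DiffProduct`, `KangarooContact`), the statements take the positive pieces as a
parameter `P : ℕ → Ideal A` and put the needed property of `℘(E,·)` as an explicit, named HYPOTHESIS whose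
certificate (an explicit permissible local sequence of blow-ups + the geometric definition of `℘`, p.17) is
recorded in the docstrings and in KILL-TEST-K1.2.md. AI review is weaker than expert review.

## What is proved (kernel, sorry-free)
* Part A (any ring `O` of characteristic `p`): two unfolding lemmas for the typed decl —
  `not_sandwichPNega_le` (a `ρ^e`-linear operator of order `≤ m+a` producing `D f ∉ M` from `f ∈ P m` puts
  `℘nega^sw(E,−a) ⊄ M`) and `sandwichPNega_le` (if every `ρ^e`-linear endomorphism maps each relevant
  `P(dm)` into `M`, then `℘nega^sw(E,−a) ≤ M`).
* Part B (`A = k[x_1,…,x_n]`, `char k = p`): the **box criterion** `box_criterion` — every `ρ^e(A)`-LINEAR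
  endomorphism maps the Frobenius power `𝔪₀^{[p^e]} = (x_i^{p^e})` into `𝔪₀` («`p^e`-th powers are
  constants») — whence `sandwichPNega_le_idealOfVars` / `sandwichNegaNoUnit_of_frobPow`: the sandwich modules
  are unit-free at the origin as soon as the positive pieces `℘(E,dm)` lie in `𝔪₀^{[p^e]}`; by pigeonhole
  (`pow_idealOfVars_le_frobPow`) only the degrees `dm ≤ n(p^e−1)` need checking.
* Part C (witness W2 = R05 #1 of the prior record, `g₂ = y² + yω₁⁵ω₂ + yω₁ω₂ + ω₁⁴`, tree `DiffProduct`):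
  `W2_sandwichPNega_not_le` — for EVERY `P` with `g₂ ∈ P 2`, the sandwich modules of degrees `−1, −2`
  (`e = 1`, `m = 2`) are NOT inside `𝔪₀` (stalk at `0` = unit ideal), the unit being
  `(ω₁⁴+1)⁻¹·∂_y∂_{ω₁}∂_{ω₂} g₂`, a box operator of order `3`; `W2_sandwichPNega_le` — degrees `≤ −3` ARE inside
  `𝔪₀`. The second file `…K12Witnesses.lean` treats W1 = `(y²+xw²,2)` (R01/R04/R08) and W3 (R05 #2): unit-free
  in every degree.

Catalogued barrier bounding the slot: `Literature.Barriers.ResolutionOfSingularities.FrobeniusTwistResolution`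
(not met by this computation). Host item: `--supports stmt-ResolutionOfSingularities-15522` (MarkedTransfer,
SIZED-ASK-L §4 S-s12), as for the typed objects.
-/

noncomputable section

set_option linter.dupNamespace false

namespace Summit.ResolutionOfSingularities.ResolutionOfSingularities.Theorems.Campaign

open Literature.AlgebraicGeometry.Resolution
open Literature.AlgebraicGeometry.Hironaka2017
open MvPolynomial

/-! ## Part A — two schema lemmas against the typed decl `sandwichPNega` (any ring) -/

section Schema

variable {O : Type*} [CommRing O] (p : ℕ) [Fact p.Prime] [CharP O p]

/-- **DEAD schema.** If some `f ∈ ℘(E,m)` (`= P m`, the `d = 1` summand of Def 5.1 (36)) and some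
`ρ^e(O)`-linear operator `D` of Grothendieck order `≤ m + a` (`0 < m`, `a ≤ m`) have `D f ∉ M`, then the
sandwich negative module `℘nega^sw(E,−a)` is not contained in `M`. Used with `M = 𝔪_ξ`: the stalk at `ξ`
is the unit ideal. Pure unfolding of `sandwichPNega` / row 008's `pTildeNeg`, `DD`. [folklore] -/
theorem not_sandwichPNega_le (e : ℕ) (P : ℕ → Ideal O) {m a : ℕ} (hm : 0 < m) (ham : a ≤ m)
    (M : Ideal O) (D : O →ₗ[(iterateFrobenius O p e).range] O) (hD : IsDiffOpLE ((iterateFrobenius O p e).range) (m + a) D)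
    {f : O} (hf : f ∈ P m) (hDf : D f ∉ M) :
    ¬ sandwichPNega p e P m a ≤ M := by
  intro hle
  apply hDf
  apply hle
  have h1 : D f ∈ S05NegativePart.DD (↥((iterateFrobenius O p e).range)) P m (a : ℤ) 1 := by
    unfold S05NegativePart.DD S05NegativePart.pPosi
    have e1 : ((1 : ℤ) * (m : ℤ) + (a : ℤ)).toNat = m + a := by
      rw [one_mul]; exact_mod_cast Int.toNat_natCast (m + a)
    have e2 : ((1 : ℤ) * (m : ℤ)).toNat = m := by
      rw [one_mul]; exact Int.toNat_natCast m
    rw [e1, e2, if_neg hm.ne']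
    exact apply_mem_diffIdeal _ hD hf
  unfold sandwichPNega S05NegativePart.pNega S05NegativePart.pTildeNeg
  have hidx : |(a : ℤ)| ≤ (1 : ℤ) * (m : ℤ) := by
    rw [one_mul, abs_of_nonneg (by positivity)]; exact_mod_cast ham
  exact (le_iSup₂ (f := fun (d : ℤ) (_ : |(a : ℤ)| ≤ d * (m : ℤ)) =>
    S05NegativePart.DD (↥((iterateFrobenius O p e).range)) P m (a : ℤ) d) (1 : ℤ) hidx) h1

/-- **ALIVE schema.** If for every `d ≥ 1` with `a ≤ d·m` every `ρ^e(O)`-linear endomorphism of `O`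
maps `℘(E,dm) = P (d m)` into the ideal `M`, then `℘nega^sw(E,−a) ≤ M`. (The order bound of Def 5.1 is
not even needed: `ρ^e(O)`-linearity alone is used downstream.) Pure unfolding. [folklore] -/
theorem sandwichPNega_le (e : ℕ) (P : ℕ → Ideal O) (m a : ℕ) (M : Ideal O)
    (hP : ∀ d : ℕ, 0 < d → a ≤ d * m →
      ∀ (D : O →ₗ[(iterateFrobenius O p e).range] O) (f : O), f ∈ P (d * m) → D f ∈ M) :
    sandwichPNega p e P m a ≤ M := by
  unfold sandwichPNega S05NegativePart.pNega S05NegativePart.pTildeNeg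
  refine iSup₂_le fun d hd => ?_
  unfold S05NegativePart.DD
  refine (diffIdeal_le_iff _).2 fun D _ f hf => ?_
  unfold S05NegativePart.pPosi at hf
  split_ifs at hf with h0
  · rw [Ideal.mem_bot] at hf
    rw [hf, map_zero]
    exact Ideal.zero_mem _
  · -- here `(d*m).toNat ≠ 0`, so `d ≥ 1` and `m ≥ 1`
    have hd0 : 0 < d := by
      rcases le_or_gt d 0 with hneg | hpos
      · exact absurd (Int.toNat_of_nonpos
          (Int.mul_nonpos_of_nonpos_of_nonneg hneg (by positivity))) h0
      · exact hpos
    obtain ⟨d', rfl⟩ := Int.eq_ofNat_of_zero_le hd0.le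
    have hd' : 0 < d' := by exact_mod_cast hd0
    have e2 : ((d' : ℤ) * (m : ℤ)).toNat = d' * m := by exact_mod_cast Int.toNat_natCast (d' * m)
    rw [e2] at hf
    have ha : a ≤ d' * m := by
      rw [abs_of_nonneg (by positivity)] at hd
      exact_mod_cast hd
    exact hP d' hd' ha D f hf

end Schema

/-! ## Part B — the box criterion over a polynomial ring `k[x_1,…,x_n]`, `char k = p` -/

section Box

variable {k : Type*} [Field k] (p : ℕ) [Fact p.Prime] [CharP k p] {n : ℕ}

/-- **Box criterion (the mechanism of the sandwich).** Every `ρ^e`-LINEAR endomorphism `D` of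
`A = k[x_1,…,x_n]` (no order hypothesis) maps `𝔪₀^{[p^e]}` into `𝔪₀`: `D(Σ x_i^{p^e} h_i) = Σ x_i^{p^e} D h_i`
because `x_i^{p^e} ∈ ρ^e(A)` is a scalar («`p^e`-th powers are constants»). [folklore] -/
theorem box_criterion (e : ℕ) (D : MvPolynomial (Fin n) k →ₗ[(iterateFrobenius (MvPolynomial (Fin n) k) p e).range]
      MvPolynomial (Fin n) k)
    {f : MvPolynomial (Fin n) k} (hf : f ∈ Ideal.span (Set.range fun i : Fin n => (X i : MvPolynomial (Fin n) k) ^ (p ^ e))) :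
    D f ∈ idealOfVars (Fin n) k := by
  rw [Ideal.mem_span_range_iff_exists_fun] at hf
  obtain ⟨c, rfl⟩ := hf
  rw [map_sum]
  refine Ideal.sum_mem _ fun i _ => ?_
  have hmem : (X i : MvPolynomial (Fin n) k) ^ p ^ e ∈ (iterateFrobenius (MvPolynomial (Fin n) k) p e).range :=
    ⟨X i, iterateFrobenius_def ..⟩
  have hsm : c i * X i ^ p ^ e
      = (⟨_, hmem⟩ : (iterateFrobenius (MvPolynomial (Fin n) k) p e).range) • c i := by
    rw [Subring.smul_def, smul_eq_mul, mul_comm]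
  rw [hsm, map_smul, Subring.smul_def, smul_eq_mul]
  refine Ideal.mul_mem_right _ _ (Ideal.pow_mem_of_mem _ ?_ _ (pow_pos (Fact.out : p.Prime).pos e))
  exact Ideal.subset_span ⟨i, rfl⟩

/-- Pigeonhole: a polynomial all of whose monomials have degree `≥ n (q − 1) + 1` lies in
`𝔪₀^{[q]}` (some exponent is `≥ q`). With `mem_pow_idealOfVars_iff` this reads
`𝔪₀^{n(q−1)+1} ≤ 𝔪₀^{[q]}`. [folklore] -/
theorem pow_idealOfVars_le_frobPow (q : ℕ) :
    idealOfVars (Fin n) k ^ (n * (q - 1) + 1) ≤ Ideal.span (Set.range fun i : Fin n => (X i : MvPolynomial (Fin n) k) ^ q) := by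
  intro f hf
  rw [mem_pow_idealOfVars_iff] at hf
  have hfrob : Ideal.span (Set.range fun i : Fin n => (X i : MvPolynomial (Fin n) k) ^ q)
      = Ideal.span ((fun s => monomial s (1 : k)) '' Set.range fun i : Fin n => Finsupp.single i q) := by
    congr 1
    ext g
    simp only [Set.mem_range, Set.mem_image, exists_exists_eq_and, X_pow_eq_monomial]
  rw [hfrob, mem_ideal_span_monomial_image]
  intro β hβ
  have hdeg := hf β hβ
  by_contra hcon
  have hlt : ∀ i : Fin n, β i ≤ q - 1 := by
    intro i
    have hi : ¬ Finsupp.single i q ≤ β := fun h => hcon ⟨Finsupp.single i q, ⟨i, rfl⟩, h⟩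
    rw [Finsupp.single_le_iff] at hi
    omega
  have : Finsupp.degree β ≤ n * (q - 1) := by
    rw [Finsupp.degree_eq_sum]
    calc ∑ i, β i ≤ ∑ _i : Fin n, (q - 1) := Finset.sum_le_sum fun i _ => hlt i
      _ = n * (q - 1) := by simp
  omega

/-- **ALIVE criterion at the origin.** If every relevant positive piece `℘(E, d m)` (`d ≥ 1`,
`a ≤ d m`) lies in the Frobenius power `𝔪₀^{[p^e]}`, then the sandwich negative module of degree `−a`
lies in `𝔪₀`: no unit is manufactured at `ξ = 0`, whatever the order bound. [folklore] -/
theorem sandwichPNega_le_idealOfVars (e : ℕ) (P : ℕ → Ideal (MvPolynomial (Fin n) k)) (m a : ℕ)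
    (hP : ∀ d : ℕ, 0 < d → a ≤ d * m → P (d * m) ≤ Ideal.span (Set.range fun i : Fin n => (X i : MvPolynomial (Fin n) k) ^ (p ^ e))) :
    sandwichPNega p e P m a ≤ idealOfVars (Fin n) k :=
  sandwichPNega_le p e P m a _ fun d hd ha D _ hf => box_criterion p e D (hP d hd ha hf)

/-- `1 ∉ 𝔪₀`. [folklore] -/
theorem one_not_mem_idealOfVars : (1 : MvPolynomial (Fin n) k) ∉ idealOfVars (Fin n) k := by
  intro h
  have h' : (C 1 : MvPolynomial (Fin n) k) ∈ idealOfVars (Fin n) k ^ 1 := by simpa using h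
  rw [C_mem_pow_idealOfVars_iff] at h'
  simp at h'

/-- **The typed property, discharged from the box criterion.** Under the same hypothesis for every
`a ≥ 1`, the typed `Prop` `SandwichNegaNoUnit p e P m` (res-L1-type-o2, p461383) HOLDS for the family `P`
over `k[x_1,…,x_n]`. [folklore] -/
theorem sandwichNegaNoUnit_of_frobPow (e : ℕ) (P : ℕ → Ideal (MvPolynomial (Fin n) k)) (m : ℕ)
    (hP : ∀ d : ℕ, 0 < d → P (d * m) ≤ Ideal.span (Set.range fun i : Fin n => (X i : MvPolynomial (Fin n) k) ^ (p ^ e))) :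
    SandwichNegaNoUnit p e P m := fun a _ h1 =>
  one_not_mem_idealOfVars
    (sandwichPNega_le_idealOfVars p e P m a (fun d hd _ => hP d hd) h1)

end Box

/-! ## Part C — witness W2 (R05 #1, tree `DiffProduct`): the unit IS manufactured in degrees `−1, −2` -/

section W2

/-- `g₂ = y² + ε ∈ 𝔪₀²` for `ε = y ω₁⁵ ω₂ + y ω₁ ω₂ + ω₁⁴` (`DiffProduct.ε`, frame `Fin 3`: `0 = ω₁`, `1 = y`,
`2 = ω₂`): the origin is a point of order `2 = b` of `E₂ = (g₂, 2)`, i.e. `0 ∈ Sing(E₂)`, and (37) holds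
there with `m = q = 2`. [folklore] -/
theorem g2_mem_sq :
    (X 1 ^ 2 + DiffProduct.ε : MvPolynomial (Fin 3) (ZMod 2)) ∈ idealOfVars (Fin 3) (ZMod 2) ^ 2 := by
  have hX : ∀ i : Fin 3, (X i : MvPolynomial (Fin 3) (ZMod 2)) ∈ idealOfVars (Fin 3) (ZMod 2) :=
    fun i => Ideal.subset_span (Set.mem_range_self i)
  rw [pow_two, DiffProduct.ε]
  refine Ideal.add_mem _ ?_ (Ideal.add_mem _ (Ideal.add_mem _ ?_ ?_) ?_)
  · rw [pow_two]; exact Ideal.mul_mem_mul (hX 1) (hX 1)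
  · exact Ideal.mul_mem_mul (Ideal.mul_mem_right _ _ (hX 1)) (hX 2)
  · exact Ideal.mul_mem_mul (Ideal.mul_mem_right _ _ (hX 1)) (hX 2)
  · rw [show (X 0 : MvPolynomial (Fin 3) (ZMod 2)) ^ 4 = X 0 ^ 3 * X 0 by ring]
    exact Ideal.mul_mem_mul (Ideal.pow_mem_of_mem _ (hX 0) 3 (by norm_num)) (hX 0)

/-- **The box operator `∂^{(1,1,1)} = ∂_y ∘ ∂_{ω₂} ∘ ∂_{ω₁}` is a sandwich operator of order `≤ 3`.** Each
first-order partial derivative of `𝔽₂[ω₁,y,ω₂]` is `ρ`-LINEAR (`∂(h² f) = h² ∂f` in characteristic `2`), hence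
a derivation over the subring `ρ(A)` of squares, of Grothendieck order `≤ 1` (tree
`Derivation.isDiffOpLE_one`); orders add under composition (tree `IsDiffOpLE.comp`). Its value on
`g₂ = y² + ε` is `ω₁⁴ + 1` (tree `DiffProduct.mixed_deriv_ε`; `∂_{ω₁} y² = 0`). No `p`-th power is
differentiated. [folklore] -/
theorem exists_boxOp_g2 :
    ∃ D : MvPolynomial (Fin 3) (ZMod 2) →ₗ[(iterateFrobenius (MvPolynomial (Fin 3) (ZMod 2)) 2 1).range]
        MvPolynomial (Fin 3) (ZMod 2),
      IsDiffOpLE ((iterateFrobenius (MvPolynomial (Fin 3) (ZMod 2)) 2 1).range) 3 D ∧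
        D (X 1 ^ 2 + DiffProduct.ε) = X 0 ^ 4 + 1 := by
  -- the partial derivatives as derivations over the subring of squares (packaged with their values)
  obtain ⟨δ, hδ⟩ : ∃ δ : Fin 3 → Derivation ((iterateFrobenius (MvPolynomial (Fin 3) (ZMod 2)) 2 1).range)
      (MvPolynomial (Fin 3) (ZMod 2)) (MvPolynomial (Fin 3) (ZMod 2)), ∀ i f, δ i f = pderiv i f :=
    ⟨fun i =>
      { toFun := pderiv i
        map_add' := map_add _
        map_smul' := by
          rintro ⟨r, h, rfl⟩ f
          simp only [Subring.smul_def, smul_eq_mul, RingHom.id_apply, iterateFrobenius_def, pow_one]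
          rw [(pderiv i).leibniz, (pderiv i).leibniz_pow]
          simp only [smul_eq_mul, two_nsmul]
          rw [CharTwo.add_self_eq_zero, mul_zero, add_zero]
        map_one_eq_zero' := (pderiv i).map_one_eq_zero
        leibniz' := fun a b => (pderiv i).leibniz a b }, fun _ _ => rfl⟩
  have hc := (Derivation.isDiffOpLE_one (δ 1)).comp
    ((Derivation.isDiffOpLE_one (δ 2)).comp (Derivation.isDiffOpLE_one (δ 0)))
  refine ⟨_, hc, ?_⟩
  simp only [LinearMap.coe_comp, Function.comp_apply, Derivation.coeFn_coe, hδ]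
  rw [map_add, map_add, map_add, DiffProduct.mixed_deriv_ε]
  simp [Derivation.leibniz_pow, pderiv_X]

/-- `ω₁⁴ + 1 ∉ 𝔪₀`: it is a unit of the local ring at the origin. [folklore] -/
theorem X0_pow_four_add_one_not_mem :
    (X 0 ^ 4 + 1 : MvPolynomial (Fin 3) (ZMod 2)) ∉ idealOfVars (Fin 3) (ZMod 2) := by
  intro h
  rw [← pow_one (idealOfVars (Fin 3) (ZMod 2)), mem_pow_idealOfVars_iff'] at h
  have h0 := h 0 (by simp)
  simp [coeff_add, coeff_X_pow] at h0

/-- **K1.2, witness W2 — DEAD-type row (kernel).** For EVERY family `P` of positive pieces with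
`g₂ = y² + ε ∈ P 2` (true of `℘(Ě,·)` for any `Ě` in which `g₂` is an LL-head of exponent `q = 2`, and of
`E₂ = (g₂, 2)` since `g₂ ∈ J`), the Frobenius-sandwich negative modules of degrees `−1` and `−2` (level
`e = 1`, `m = q = 2`) are NOT contained in the maximal ideal of the origin: their stalk at `ξ = 0` is the
unit ideal, the unit being `(ω₁⁴+1)⁻¹ · ∂_y∂_{ω₁}∂_{ω₂} g₂ = 1` — a box operator of order `3 ≤ m + a`; no `p`-th
power is differentiated. Replaces the role of «`1 ∈ ℘nega`» (prior C1) for the SANDWICH modules on this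
witness; NOT a statement of the manuscript. [folklore] -/
theorem W2_sandwichPNega_not_le (P : ℕ → Ideal (MvPolynomial (Fin 3) (ZMod 2)))
    (hg : (X 1 ^ 2 + DiffProduct.ε : MvPolynomial (Fin 3) (ZMod 2)) ∈ P 2) (a : ℕ) (ha : a = 1 ∨ a = 2) :
    ¬ sandwichPNega 2 1 P 2 a ≤ idealOfVars (Fin 3) (ZMod 2) := by
  obtain ⟨D, hD, hDg⟩ := exists_boxOp_g2
  exact not_sandwichPNega_le 2 1 P (by norm_num) (by omega) _ D (hD.of_le (by omega)) hg
    (by rw [hDg]; exact X0_pow_four_add_one_not_mem)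

/-- **K1.2, witness W2 — the other degrees (kernel).** In degrees `−a ≤ −3` only `d ≥ 2` contributes
(`dm ≥ a`), and `℘(E,2d) ⊆ 𝔪₀^{2d} ⊆ 𝔪₀⁴ ⊆ 𝔪₀^{[2]}` (three variables), so those sandwich modules ARE inside
`𝔪₀`: the degree set where the unit appears is exactly `{1, 2}`. Hypothesis = «`ord_0 f ≥ 2d` on `℘(E,2d)`»
(`0 ∈ Sing`, `g2_mem_sq`). [folklore] -/
theorem W2_sandwichPNega_le (P : ℕ → Ideal (MvPolynomial (Fin 3) (ZMod 2)))
    (hP : ∀ d : ℕ, 2 ≤ d → P (d * 2) ≤ idealOfVars (Fin 3) (ZMod 2) ^ (d * 2)) (a : ℕ) (ha : 3 ≤ a) :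
    sandwichPNega 2 1 P 2 a ≤ idealOfVars (Fin 3) (ZMod 2) :=
  sandwichPNega_le_idealOfVars 2 1 P 2 a fun d _ had => by
    have h2 : 2 ≤ d := by omega
    have h4 : idealOfVars (Fin 3) (ZMod 2) ^ (d * 2) ≤ idealOfVars (Fin 3) (ZMod 2) ^ (3 * (2 - 1) + 1) :=
      Ideal.pow_le_pow_right (by omega)
    exact (hP d h2).trans (h4.trans (by simpa using pow_idealOfVars_le_frobPow (n := 3) (k := ZMod 2) 2))

end W2

end Summit.ResolutionOfSingularities.ResolutionOfSingularities.Theorems.Campaign
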